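import Mathlib.LinearAlgebra.Semisimple
import Mathlib.LinearAlgebra.Matrix.ToLin
import HarnessLib

/-!
# K2 · E3 ∕ U12-d, road (S-d) file 3b kit — semisimplicity of a matrix is preserved by a ring ISOMORPHISM of the coefficients:
# `IsSemisimple (toLin' A) → IsSemisimple (toLin' (A.map e))` for `e : R ≃+* S`

HCML Track B «K2-LIT», cell `pub/hodgecm-mathlib`, crux H413 = `stmt-HodgeConjecture-24833` (`--supports … --as helper`), seat `hodgecm-mathlib-K2E3-p12` (g0),
socket #12 `sig_K2E3NormalizedCharBddNearSemisimple`, sub-socket (S-d).  The socket states semisimplicity of `s ∈ U_N(H)(L⁺_v)` as `Module.End.IsSemisimple (toLin' MAT(s))`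
over the coefficient ring `R = L ⊗ L⁺_v = Π_{w∣v} L_w`; the field-model chart (★ `K2E3SemisimpleOrbitChartUnitary`, ★ `K2E3CayleySliceConjugatesNhdsField`) needs it over
the FIELD `L_w` after the one-place identification `R ≃+* L_w` at a non-split place (★ `LocalRing.evalEquiv`).  THIS FILE is the transfer lemma, Mathlib-only:
**`isSemisimple_toLin'_map_ringEquiv`** — for a ring isomorphism `e : R ≃+* S` and `A ∈ M_n(R)`, `toLin' A` semisimple ⇒ `toLin' (A.map e)` semisimple (Mathlib
`Module.End.isSemisimple_iff`: invariant complements are transported along the `e`-semilinear equivalence `x ↦ e ∘ x` of `R^n` with `S^n`, under which `toLin' A` and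
`toLin' (A.map e)` correspond, `RingHom.map_mulVec`); and the `iff` form `isSemisimple_toLin'_map_ringEquiv_iff`.
THEOREMS ONLY; no `sorry`; axioms ⊆ the trio.  HONEST LABEL: linear algebra; HC_CM is proved only modulo the 7 printed citations (2 remaining named inputs: hLiu418 =
stmt-HodgeConjecture-24832, h413 = stmt-HodgeConjecture-24833) until rung 0 closes.

## References
* [Borel1991] A. Borel, *Linear Algebraic Groups*, 2nd ed. (1991), I.4 (4.2, 4.4) (semisimple endomorphisms; stability under field∕ring automorphisms).
* [HarishChandra1999AdmissibleDistributions] Harish-Chandra (DeBacker–Sally), *Admissible Invariant Distributions on Reductive p-adic Groups* (1999), §18 p. 79.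
-/

set_option autoImplicit false
set_option linter.dupNamespace false

namespace Summit.HodgeConjecture.HodgeConjecture.Cruxes.H413.K2E3SemisimpleMatrixRingEquivTransfer

variable {R S : Type*} [CommRing R] [CommRing S] {n : Type*} [Fintype n] [DecidableEq n]

/-- The `e`-semilinear coordinate map `x ↦ e ∘ x : Rⁿ → Sⁿ` intertwines `toLin' A` and `toLin' (A.map e)` (Mathlib `RingHom.map_mulVec`). [folklore] -/
theorem toLin'_map_comp_apply (e : R ≃+* S) (A : Matrix n n R) (x : n → R) :
    Matrix.toLin' (A.map (e : R →+* S)) (fun i => e (x i)) = fun i => e (Matrix.toLin' A x i) := by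
  funext i
  rw [Matrix.toLin'_apply, Matrix.toLin'_apply]
  exact (RingHom.map_mulVec (e : R →+* S) A x i).symm

/-- **Semisimplicity of a matrix is preserved by a ring isomorphism of the coefficients**: `toLin' A` semisimple ⇒ `toLin' (A.map e)` semisimple (`e : R ≃+* S`).
Invariant submodules of `Sⁿ` pull back along `x ↦ e ∘ x` to invariant submodules of `Rⁿ`; an invariant complement there pushes forward to an invariant complement.
[cite: Borel1991, I.4 (4.2, 4.4)] -/
theorem isSemisimple_toLin'_map_ringEquiv (e : R ≃+* S) (A : Matrix n n R) (hA : Module.End.IsSemisimple (Matrix.toLin' A)) :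
    Module.End.IsSemisimple (Matrix.toLin' (A.map (e : R →+* S))) := by
  haveI : RingHomInvPair ((e : R →+* S)) (↑e.symm : S →+* R) := RingHomInvPair.of_ringEquiv e
  haveI : RingHomInvPair (↑e.symm : S →+* R) ((e : R →+* S)) := RingHomInvPair.of_ringEquiv_symm e
  -- the semilinear coordinate equivalence
  let φ : (n → R) ≃ₛₗ[(e : R →+* S)] (n → S) :=
    { toFun := fun x i => e (x i)
      invFun := fun y i => e.symm (y i)
      map_add' := fun x y => funext fun i => map_add e (x i) (y i)
      map_smul' := fun c x => funext fun i => by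
        simp only [Pi.smul_apply, smul_eq_mul, map_mul, RingHom.coe_coe]
      left_inv := fun x => funext fun i => e.symm_apply_apply (x i)
      right_inv := fun y => funext fun i => e.apply_symm_apply (y i) }
  have hφ : ∀ x, Matrix.toLin' (A.map (e : R →+* S)) (φ x) = φ (Matrix.toLin' A x) := fun x => toLin'_map_comp_apply e A x
  rw [Module.End.isSemisimple_iff] at hA ⊢
  intro q hq
  -- pull back `q`
  set p : Submodule R (n → R) := q.comap (φ : (n → R) →ₛₗ[(e : R →+* S)] (n → S)) with hp
  have hpinv : p ∈ Module.End.invtSubmodule (Matrix.toLin' A) := by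
    rw [Module.End.mem_invtSubmodule]
    intro x hx
    rw [Submodule.mem_comap] at hx ⊢
    change φ (Matrix.toLin' A x) ∈ q
    rw [← hφ]
    rw [Module.End.mem_invtSubmodule] at hq
    exact hq hx
  obtain ⟨p', hp'inv, hc⟩ := hA p hpinv
  -- push the complement forward
  refine ⟨p'.map (φ : (n → R) →ₛₗ[(e : R →+* S)] (n → S)), ?_, ?_⟩
  · rw [Module.End.mem_invtSubmodule]
    intro y hy
    rw [Submodule.mem_comap]
    obtain ⟨x, hx, rfl⟩ := Submodule.mem_map.1 hy
    rw [Module.End.mem_invtSubmodule] at hp'inv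
    refine Submodule.mem_map.2 ⟨Matrix.toLin' A x, hp'inv hx, ?_⟩
    exact (hφ x).symm
  · have hq' : q = p.map (φ : (n → R) →ₛₗ[(e : R →+* S)] (n → S)) := by
      rw [hp, Submodule.map_comap_eq_of_surjective φ.surjective]
    rw [hq']
    exact (Submodule.orderIsoMapComap φ).isCompl hc

/-- The `iff` form (apply the lemma to `e` and to `e.symm`). [cite: Borel1991, I.4 (4.2, 4.4)] -/
theorem isSemisimple_toLin'_map_ringEquiv_iff (e : R ≃+* S) (A : Matrix n n R) :
    Module.End.IsSemisimple (Matrix.toLin' (A.map (e : R →+* S))) ↔ Module.End.IsSemisimple (Matrix.toLin' A) := by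
  refine ⟨fun h => ?_, isSemisimple_toLin'_map_ringEquiv e A⟩
  have h' := isSemisimple_toLin'_map_ringEquiv e.symm (A.map (e : R →+* S)) h
  have hAA : (A.map (e : R →+* S)).map (e.symm : S →+* R) = A := by
    ext i j
    simp only [Matrix.map_apply, RingHom.coe_coe, RingEquiv.symm_apply_apply]
  rwa [hAA] at h'

end Summit.HodgeConjecture.HodgeConjecture.Cruxes.H413.K2E3SemisimpleMatrixRingEquivTransfer
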